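import Mathlib
import HarnessLib
import Summits.HubbardSuperconductivity.HubbardSuperconductivity.Theorems.WeakCouplingBCSKlThirdOrderSlot

/-!
# WeakCouplingBCS — KL certificate: the third-order form-bound slot FROM HILBERT–SCHMIDT ENCLOSURES (statements first, kit-free)

The two-sided hypothesis kind `KlThirdOrder.FormBound tp a b M` of ✓ p732729 (`|⟨ψ, K₃ ψ⟩_{σ_μ}| ≤ M` on every normalised channel state) is what
the explicit-`U₀` rows consume; the lane's kit objects, however, are HILBERT–SCHMIDT norms (of entrywise majorants) of the chain kernel and of
the two-loop kernel.  This file records the exact analytic step in between — a post-KILL seed for moving the literal `M₃` toward kernel-checkable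
enclosures — as two HS-level hypothesis kinds and one theorem:

* `KlThirdOrder.ChainHS tp a b H`   : for `μ ∈ [a, b]`, `(k,k') ↦ χ₀(k−k')² + χ₀(k+k')²` is in `L²(σ_μ ⊗ σ_μ)` with norm `≤ H`;
* `KlThirdOrder.TwoLoopHS tp a b T` : for `μ ∈ [a, b]`, `(k,k') ↦ T_V(k,k') + T_P(k,k')` is in `L²(σ_μ ⊗ σ_μ)` with norm `≤ T`;
* **`KlThirdOrder.formBound_of_HS`** : finite `σ_μ` on the window + `ChainHS … H` + `TwoLoopHS … T` ⇒ `FormBound tp a b (H + T)`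
  (Fubini for the quadratic form + Cauchy–Schwarz on `σ_μ ⊗ σ_μ`, ✓ `integral_mul_integral_mul_eq_integral_prod` / `abs_integral_mul_integral_mul_le`),
  hence (`klFormBound_zero_of_HS`) at `t′ = 0` on any window inside `(−4, 0)` with the finiteness discharged by ✓ `stub_klFiniteMeasure`.

Honest framing: slots only — `H`, `T` are hypotheses (the chain one is second-order-type data: `‖χ₀(·±·)²‖_{L²} = ‖χ₀(·±·)‖²_{L⁴}`, boundable from
`sup χ₀` and `σ(F)`; the two-loop one is the genuinely third-order object); nothing numerical is asserted; register expectation 0.00; RECORD ≠ DECIDED;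
a Kohn–Luttinger channel statement is not ODLRO and nothing here proves superconductivity in the Hubbard model.
Filed `--supports stmt-HubbardSuperconductivity-0158`.

References: S. Raghu, S. A. Kivelson, D. J. Scalapino, Phys. Rev. B 81 (2010) 224505, §V (25), App. A; M. Reed, B. Simon,
*Methods of Modern Mathematical Physics I*, Thm. VI.23 (Hilbert–Schmidt kernels).
-/

noncomputable section

-- the tree's namespace `Summit.<Summit>.<Problem>.Theorems` repeats the summit name by design (D-0017)
set_option linter.dupNamespace false

namespace Summit.HubbardSuperconductivity.HubbardSuperconductivity.Theorems

open MeasureTheory Literature.MathematicalPhysics.QuantumLattice CwKLChiralWindow KlThirdOrder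

/-! ### §1 The two Hilbert–Schmidt hypothesis kinds -/

/-- **Chain-kernel Hilbert–Schmidt enclosure — HYPOTHESIS KIND** (asserts nothing): on `μ ∈ [a, b]` the third-order chain kernel
`χ₀(k−k')² + χ₀(k+k')²` of the `t`–`t′` band is square integrable for `σ_μ ⊗ σ_μ` with `L²` norm at most `H`. [folklore] -/
def KlThirdOrder.ChainHS (tp a b H : ℝ) : Prop :=
  ∀ μ ∈ Set.Icc a b,
    MemLp (fun z : Momentum × Momentum => chainKernel3 (squareDispersion 1 tp) μ z.1 z.2) 2
        ((fermiCurveMeasure (squareDispersion 1 tp) μ).prod (fermiCurveMeasure (squareDispersion 1 tp) μ)) ∧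
      Real.sqrt (∫ z, (chainKernel3 (squareDispersion 1 tp) μ z.1 z.2) ^ 2
        ∂(fermiCurveMeasure (squareDispersion 1 tp) μ).prod (fermiCurveMeasure (squareDispersion 1 tp) μ)) ≤ H

/-- **Two-loop-kernel Hilbert–Schmidt enclosure — HYPOTHESIS KIND** (asserts nothing): on `μ ∈ [a, b]` the two-loop third-order kernel
`T_V + T_P` of the `t`–`t′` band is square integrable for `σ_μ ⊗ σ_μ` with `L²` norm at most `T`. [folklore] -/
def KlThirdOrder.TwoLoopHS (tp a b T : ℝ) : Prop :=
  ∀ μ ∈ Set.Icc a b,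
    MemLp (fun z : Momentum × Momentum =>
        twoLoopV (squareDispersion 1 tp) μ z.1 z.2 + twoLoopP (squareDispersion 1 tp) μ z.1 z.2) 2
        ((fermiCurveMeasure (squareDispersion 1 tp) μ).prod (fermiCurveMeasure (squareDispersion 1 tp) μ)) ∧
      Real.sqrt (∫ z, (twoLoopV (squareDispersion 1 tp) μ z.1 z.2 + twoLoopP (squareDispersion 1 tp) μ z.1 z.2) ^ 2
        ∂(fermiCurveMeasure (squareDispersion 1 tp) μ).prod (fermiCurveMeasure (squareDispersion 1 tp) μ)) ≤ T

/-! ### §2 Form bound from Hilbert–Schmidt bounds -/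

/-- **The kernel form of a sum of two `L²(σ ⊗ σ)` kernels splits**, for `ψ ∈ L²(σ)` and s-finite `σ`:
`kform σ (K₁ + K₂) ψ = kform σ K₁ ψ + kform σ K₂ ψ` (both sides are the product integrals). [folklore] -/
theorem KlThirdOrder.kform_add_of_memLp {σ : Measure Momentum} [SFinite σ] {K₁ K₂ : Momentum → Momentum → ℝ} {ψ : Momentum → ℝ}
    (hψ : MemLp ψ 2 σ) (h₁ : MemLp (fun z : Momentum × Momentum => K₁ z.1 z.2) 2 (σ.prod σ))
    (h₂ : MemLp (fun z : Momentum × Momentum => K₂ z.1 z.2) 2 (σ.prod σ)) :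
    kform σ (fun k k' => K₁ k k' + K₂ k k') ψ = kform σ K₁ ψ + kform σ K₂ ψ := by
  unfold kform
  have e₁ := integral_mul_integral_mul_eq_integral_prod (M := fun z : Momentum × Momentum => K₁ z.1 z.2) hψ h₁
  have e₂ := integral_mul_integral_mul_eq_integral_prod (M := fun z : Momentum × Momentum => K₂ z.1 z.2) hψ h₂
  have e₃ := integral_mul_integral_mul_eq_integral_prod (M := fun z : Momentum × Momentum => K₁ z.1 z.2 + K₂ z.1 z.2) hψ (h₁.add h₂)
  simp only at e₁ e₂ e₃
  have i₁ : Integrable (fun z : Momentum × Momentum => K₁ z.1 z.2 * (ψ z.1 * ψ z.2)) (σ.prod σ) :=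
    h₁.integrable_mul (memLp_two_tensor hψ)
  have i₂ : Integrable (fun z : Momentum × Momentum => K₂ z.1 z.2 * (ψ z.1 * ψ z.2)) (σ.prod σ) :=
    h₂.integrable_mul (memLp_two_tensor hψ)
  rw [e₁, e₂, e₃, ← integral_add i₁ i₂]
  refine integral_congr_ae (Filter.Eventually.of_forall fun z => ?_)
  ring

/-- **Hilbert–Schmidt bound of a kernel form on a normalised state**: `ψ ∈ L²(σ)`, `∫ψ² = 1`, `K ∈ L²(σ ⊗ σ)` with norm `≤ B` ⇒ `|kform σ K ψ| ≤ B`.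
[cite: ReedSimon1972, Thm. VI.23] -/
theorem KlThirdOrder.abs_kform_le_of_memLp {σ : Measure Momentum} [SFinite σ] {K : Momentum → Momentum → ℝ} {ψ : Momentum → ℝ} {B : ℝ}
    (hψ : MemLp ψ 2 σ) (hψ1 : ∫ k, ψ k ^ 2 ∂σ = 1) (hK : MemLp (fun z : Momentum × Momentum => K z.1 z.2) 2 (σ.prod σ))
    (hB : Real.sqrt (∫ z, (K z.1 z.2) ^ 2 ∂σ.prod σ) ≤ B) : |kform σ K ψ| ≤ B := by
  unfold kform
  have h := abs_integral_mul_integral_mul_le (M := fun z : Momentum × Momentum => K z.1 z.2) hψ hK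
  simp only at h
  rw [hψ1, one_mul] at h
  exact h.trans hB

/-- **`FormBound` from the two Hilbert–Schmidt enclosures.** On a window where every `σ_μ` is finite, `ChainHS tp a b H` and `TwoLoopHS tp a b T`
give `FormBound tp a b (H + T)`: for every normalised channel state `|⟨ψ, K₃ ψ⟩| ≤ |⟨ψ, chain ψ⟩| + |⟨ψ, (T_V + T_P) ψ⟩| ≤ H + T`.
[cite: ReedSimon1972, Thm. VI.23] -/
theorem KlThirdOrder.formBound_of_HS {tp a b H T : ℝ}
    (hfin : ∀ μ ∈ Set.Icc a b, IsFiniteMeasure (fermiCurveMeasure (squareDispersion 1 tp) μ))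
    (hC : KlThirdOrder.ChainHS tp a b H) (hT : KlThirdOrder.TwoLoopHS tp a b T) : KlThirdOrder.FormBound tp a b (H + T) := by
  intro μ hμ χ ψ hψ
  haveI := hfin μ hμ
  obtain ⟨h1, hH⟩ := hC μ hμ
  obtain ⟨h2, hT'⟩ := hT μ hμ
  have hsplit : kform (fermiCurveMeasure (squareDispersion 1 tp) μ) (klThirdOrderKernel (squareDispersion 1 tp) μ) ψ =
      kform (fermiCurveMeasure (squareDispersion 1 tp) μ) (chainKernel3 (squareDispersion 1 tp) μ) ψ +
        kform (fermiCurveMeasure (squareDispersion 1 tp) μ)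
          (fun k k' => twoLoopV (squareDispersion 1 tp) μ k k' + twoLoopP (squareDispersion 1 tp) μ k k') ψ := by
    have e : klThirdOrderKernel (squareDispersion 1 tp) μ =
        fun k k' => chainKernel3 (squareDispersion 1 tp) μ k k' +
          (twoLoopV (squareDispersion 1 tp) μ k k' + twoLoopP (squareDispersion 1 tp) μ k k') := by
      funext k k'; simp only [klThirdOrderKernel]; ring
    rw [e]
    exact kform_add_of_memLp hψ.1 h1 h2
  rw [hsplit]
  exact (abs_add_le _ _).trans (add_le_add (abs_kform_le_of_memLp hψ.1 hψ.2.1 h1 hH) (abs_kform_le_of_memLp hψ.1 hψ.2.1 h2 hT'))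

/-- **`t′ = 0`**: on a window `[a, b] ⊆ (−4, 0)` the Fermi-curve measures are finite (✓ `stub_klFiniteMeasure`), so `ChainHS 0 a b H` and
`TwoLoopHS 0 a b T` give `FormBound 0 a b (H + T)` outright. [cite: ReedSimon1972, Thm. VI.23] -/
theorem klFormBound_zero_of_HS {a b H T : ℝ} (ha : -4 < a) (hb : b < 0) (hC : KlThirdOrder.ChainHS 0 a b H)
    (hT : KlThirdOrder.TwoLoopHS 0 a b T) : KlThirdOrder.FormBound 0 a b (H + T) :=
  KlThirdOrder.formBound_of_HS
    (fun μ hμ => stub_klFiniteMeasure stub_klGradient stub_klHausdorffFinite μ ⟨lt_of_lt_of_le ha hμ.1, lt_of_le_of_lt hμ.2 hb⟩) hC hT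

/-- **Corollary on the doping window** `μ ∈ [−0.42749, −0.1775]` (`δ ∈ [0.10, 0.20]`): HS enclosures `H`, `T` there feed the window row of
✓ p732729 directly — for `0 ≤ H + T`, `0 < U < klU0 (437/16384) (H + T) 1`, `χ ≠ B1g`: `channelInf3 ε₀ μ U B1g < channelInf3 ε₀ μ U χ`, modulo
the three records' `EnclosuresB1g`. [cite: RaghuKivelsonScalapino2010, §III Fig. 2, §IV] -/
theorem klChannelInf3_B1g_lt_window_d010_d020_of_HS (hA : klCertB1gWinA.EnclosuresB1g) (hB : klCertB1gWinB.EnclosuresB1g)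
    (hC : klCertB1gWinC.EnclosuresB1g) {H T : ℝ} (hHT : 0 ≤ H + T) (hCh : KlThirdOrder.ChainHS 0 (-0.42749) (-0.1775) H)
    (hTl : KlThirdOrder.TwoLoopHS 0 (-0.42749) (-0.1775) T)
    {μ : ℝ} (hμ : μ ∈ Set.Icc (-0.42749 : ℝ) (-0.1775)) {U : ℝ} (hU0 : 0 < U) (hU : U < klU0 (437 / 16384) (H + T) 1)
    {χ : D4Irrep} (hχ : χ ≠ D4Irrep.B1g) :
    channelInf3 (squareDispersion 1 0) μ U D4Irrep.B1g < channelInf3 (squareDispersion 1 0) μ U χ :=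
  klChannelInf3_B1g_lt_window_d010_d020 hA hB hC hHT (klFormBound_zero_of_HS (by norm_num) (by norm_num) hCh hTl) hμ hU0 hU hχ

end Summit.HubbardSuperconductivity.HubbardSuperconductivity.Theorems

end
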